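import Summits.CriticalPhenomena.PercolationContinuityZ3.Theorems.PercNearOneGluingNoHeavyLowerTailSahiSliceMinimumLaplacian

/-!
# `NoHeavyLowerTail` (crux stmt-CriticalPhenomena-4575), Sahi programme P2 (gen 18): THE SUM-FORM PRINCIPLE AT CRITICAL POINTS —
# "at an interior critical point `E₃` dominates the average of its facets" — typed, reduced to Kahn's Conjecture 5 WITHOUT the flatness
# argument, and proved for two families

Support file (`--supports stmt-CriticalPhenomena-4575`; companion of `…SahiSliceMinimumLaplacian`).  Nothing here asserts Kahn's or Sahi's
conjecture: the principle is TYPED (`@[conjecture]`) and the file proves its REDUCTION and two solved families.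

THE STATEMENT (`SumFormPrinciple`; this lane, gen 18).  For a product measure `μ_p` with live coins `L` and three increasing events write
`G = E₃(μ_p)` and `G_e^b = E₃(μ_{p[e↦b]})` (`b ∈ {0,1}`) for the facet values.  **SUM-FORM-crit: if every live fibre is stationary
(`∂E₃/∂p_e = 0`, `e ∈ L`) then `Σ_{e∈L} [(1−p_e)·G_e^0 + p_e·G_e^1] ≤ |L|·G`** — `E₃` at a critical point dominates the `μ_p`-weighted average of its
`2|L|` facets; equivalently `Σ_e B_e ≥ 0` for the chord defects `B_e = G − (1−p_e)G_e^0 − p_eG_e^1` of the census literature (ttrl's 'sum form'),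
equivalently (chord identity `cubicE3_chord_sub`) `W/2 + A₃ ≤ 0` with `W = Σ_e p_e(1−p_e)Φ_e″` the weighted Laplacian of `…Laplacian` and
`A₃ = Σ_e p_e(1−p_e)(1−2p_e)c₃(e)` (`G3_chord_sub` below); it is the first step `β₀ ≥ β₁` of the facet-average cascade of the memo and the
condition `Ξ̃′(0) ≤ 0` for the 'reveal' martingale.  At general points it is FALSE (ttrl's sum-form negatives, e.g. K = 4 at p = (1/5,1/5,1/5,4/5));
at interior critical points it holds in every census (8,607 random + adversarial critical points, m ≤ 6; min Σ_eB_e = 0.142·G·|L|… see memo).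

THE REDUCTION (`masterFamilyNonneg_three_of_sumForm`): **SUM-FORM-crit ⟹ `MasterFamilyNonneg 3`** (hence Kahn's Conjecture 5 and Sahi's `C₃`).
Unlike the NIM route (`…Critical`) no flatness lemma and no sign bookkeeping is needed: induct on the number of live coins, minimise `G` over
the sub-cube of the live set (`exists_min_subcube`); either a coin froze (induction) or every live fibre is stationary (Fermat,
`fibreSlope_eq_zero_of_min`), and then SUM-FORM bounds `|L|·G` below by a nonnegative combination of facet values, each `≥ 0` by induction
(`card_liveSet_update_lt`).

FAMILIES (termwise, `sumForm_of_forall`): a constant member (`chord_le_const`: `c₃ = 0`, `Φ″ ≤ 0`) and diagonal triples (`chord_le_diag`: concave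
fibres), via `chord_le_of_concave` — for a fibre cubic with `Φ″(0), Φ″(1) ≤ 0` the chord lies below the fibre:
`(1−s)Φ(0) + sΦ(1) − Φ(s) = s(1−s)[(2−s)Φ″(0) + (1+s)Φ″(1)]/6 ≤ 0`.  HONEST LABEL: a typed conjecture with its reduction; `C₃` remains OPEN. [this work]
-/

noncomputable section

open scoped Classical Topology

namespace Summit.CriticalPhenomena.PercolationContinuityZ3.Theorems

open Finset Function Filter
open Literature.Combinatorics.Sahi2008
open Literature.Probability.Percolation.DecisionTree (ind ind_of_mem ind_of_not_mem ind_nonneg)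

namespace SahiSliceMinimum

variable {ι : Type} [Fintype ι]

/-! ### The statement (typed) -/

/-- **THE SUM-FORM PRINCIPLE AT CRITICAL POINTS (SUM-FORM-crit)** (this lane): for every finite `ι`, every `p : ι → [0,1]` with a live coin and
every three increasing events, if `∂E₃/∂p_e = 0` for every live coin `e` then
`Σ_{e live} [(1−p_e)·E₃(μ_{p[e↦0]}) + p_e·E₃(μ_{p[e↦1]})] ≤ #live · E₃(μ_p)`.  Census-clean at critical points (false at general points).
An obligation / hypothesis; never import it as a fact. [this work] [status: open; conjecture] -/
@[conjecture] def SumFormPrinciple : Prop :=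
  ∀ (ι : Type) [Fintype ι] (p : ι → unitInterval) (U : Fin 3 → Set (Set ι)),
    (∀ j, IsUpperSet (U j)) → (liveSet p).Nonempty →
      (∀ e ∈ liveSet p, fibreSlope p e (ind (U 0)) (ind (U 1)) (ind (U 2)) = 0) →
        ∑ e ∈ liveSet p, ((1 - (p e : ℝ)) * G3 U (update p e 0) + (p e : ℝ) * G3 U (update p e 1)) ≤
          ((liveSet p).card : ℝ) * G3 U p

/-! ### The chord defect of `G3` along one coin -/

/-- `G3` at `p` is the fibre cubic of any coin evaluated at the actual bias. [this work] -/
theorem G3_eq_cubicE3 (U : Fin 3 → Set (Set ι)) (p : ι → unitInterval) (e : ι) :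
    G3 U p = cubicE3 p e (ind (U 0)) (ind (U 1)) (ind (U 2)) (p e : ℝ) := by
  conv_lhs => rw [← update_eq_self e p]
  exact G3_update_eq U p e (p e)

/-- **Chord identity for `G3`**: `(1−p_e)G(p[e↦0]) + p_e G(p[e↦1]) − G(p) = ½p_e(1−p_e)Φ_e″(p_e) + p_e(1−p_e)(1−2p_e)·c₃(e)`. [this work] -/
theorem G3_chord_sub (U : Fin 3 → Set (Set ι)) (p : ι → unitInterval) (e : ι) :
    (1 - (p e : ℝ)) * G3 U (update p e 0) + (p e : ℝ) * G3 U (update p e 1) - G3 U p =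
      (p e : ℝ) * (1 - (p e : ℝ)) / 2 * cubicE3Deriv2 p e (ind (U 0)) (ind (U 1)) (ind (U 2)) (p e) +
        (p e : ℝ) * (1 - (p e : ℝ)) * (1 - 2 * (p e : ℝ)) *
          (secDelta p e (ind (U 0)) * secDelta p e (ind (U 1)) * secDelta p e (ind (U 2))) := by
  rw [G3_update_eq, G3_update_eq, G3_eq_cubicE3 U p e, Set.Icc.coe_zero, Set.Icc.coe_one]
  exact cubicE3_chord_sub p e _ _ _ _

/-! ### The reduction: SUM-FORM-crit ⟹ Kahn -/

/-- **SUM-FORM-crit implies the master family inequality of order 3** (`E₃ ≥ 0` for three increasing events under every product measure).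
Minimal-counterexample argument without flatness: at an interior minimiser with all live fibres stationary, `|L|·G` dominates a nonnegative
combination of facet values, which are `≥ 0` by induction on the number of live coins. [this work] -/
theorem masterFamilyNonneg_three_of_sumForm (hSF : SumFormPrinciple) : MasterFamilyNonneg 3 := by
  intro ι _ p U hU
  suffices H : ∀ (c : ℕ) (q : ι → unitInterval), (liveSet q).card = c → 0 ≤ G3 U q from H _ p rfl
  intro c
  induction c using Nat.strong_induction_on with
  | _ c ih =>
    intro p hc
    by_cases hlive : (liveSet p).Nonempty
    swap
    · have hfrozen : ∀ e, (p e : ℝ) = 0 ∨ (p e : ℝ) = 1 := fun e =>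
        eq_zero_or_eq_one_of_not_live p e fun hl => hlive ⟨e, (mem_liveSet p e).2 hl⟩
      show 0 ≤ sahiE (bernoulliWeight p) 3 (fun j => ind (U j))
      rw [sahiE_eq_zero_of_frozen p hfrozen 1]
    obtain ⟨q, hq, hmin⟩ := exists_min_subcube U p
    have hpq : G3 U q ≤ G3 U p := hmin p (mem_subcube_self p _)
    suffices hq0 : 0 ≤ G3 U q from le_trans hq0 hpq
    have hsub : liveSet q ⊆ liveSet p := liveSet_subset_of_mem_subcube hq
    by_cases hstrict : liveSet q = liveSet p
    swap
    · have hlt : (liveSet q).card < c := by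
        rw [← hc]
        exact Finset.card_lt_card (Finset.ssubset_iff_subset_ne.2 ⟨hsub, hstrict⟩)
      exact ih _ hlt q rfl
    have hliveq : (liveSet q).Nonempty := by rw [hstrict]; exact hlive
    have hstat : ∀ e ∈ liveSet q, fibreSlope q e (ind (U 0)) (ind (U 1)) (ind (U 2)) = 0 :=
      fun e he => fibreSlope_eq_zero_of_min hq hmin (hsub he) he
    have hsum := hSF ι q U hU hliveq hstat
    -- every facet value is ≥ 0 by induction
    have hfac : ∀ e ∈ liveSet q, ∀ (b : unitInterval), ((b : ℝ) = 0 ∨ (b : ℝ) = 1) → 0 ≤ G3 U (update q e b) := by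
      intro e he b hb
      have hlt : (liveSet (update q e b)).card < c := by
        have h := card_liveSet_update_lt q he b hb
        rw [hstrict, hc] at h
        exact h
      exact ih _ hlt _ rfl
    have hlhs : 0 ≤ ∑ e ∈ liveSet q, ((1 - (q e : ℝ)) * G3 U (update q e 0) + (q e : ℝ) * G3 U (update q e 1)) := by
      refine Finset.sum_nonneg fun e he => ?_
      have h0 : 0 ≤ (q e : ℝ) := (q e).2.1
      have h1 : (q e : ℝ) ≤ 1 := (q e).2.2
      have hG0 := hfac e he 0 (Or.inl Set.Icc.coe_zero)
      have hG1 := hfac e he 1 (Or.inr Set.Icc.coe_one)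
      nlinarith
    have hcard : (0 : ℝ) < ((liveSet q).card : ℝ) := by exact_mod_cast Finset.card_pos.2 hliveq
    nlinarith

/-- **SUM-FORM-crit implies Kahn's Conjecture 5.** [this work] -/
theorem kahnConjecture_of_sumForm (h : SumFormPrinciple) : KahnConjecture :=
  masterFamilyNonneg_three_iff_kahnConjecture.1 (masterFamilyNonneg_three_of_sumForm h)

/-- **SUM-FORM-crit implies Sahi's `C₃`.** [this work] -/
theorem sahiConjecture_three_of_sumForm (h : SumFormPrinciple) : SahiConjecture 3 :=
  sahiConjecture_three_iff_kahnConjecture.2 (kahnConjecture_of_sumForm h)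

/-! ### The termwise route and two families -/

/-- Termwise route: if every live chord lies below the fibre (`(1−p_e)G_e⁰ + p_eG_e¹ ≤ G`), the SUM-FORM conclusion holds. [this work] -/
theorem sumForm_of_forall (U : Fin 3 → Set (Set ι)) (p : ι → unitInterval)
    (h : ∀ e ∈ liveSet p, (1 - (p e : ℝ)) * G3 U (update p e 0) + (p e : ℝ) * G3 U (update p e 1) ≤ G3 U p) :
    ∑ e ∈ liveSet p, ((1 - (p e : ℝ)) * G3 U (update p e 0) + (p e : ℝ) * G3 U (update p e 1)) ≤
      ((liveSet p).card : ℝ) * G3 U p := by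
  calc ∑ e ∈ liveSet p, ((1 - (p e : ℝ)) * G3 U (update p e 0) + (p e : ℝ) * G3 U (update p e 1))
      ≤ ∑ _e ∈ liveSet p, G3 U p := Finset.sum_le_sum h
    _ = ((liveSet p).card : ℝ) * G3 U p := by rw [Finset.sum_const, nsmul_eq_mul]

/-- **Concave fibre ⟹ chord below the fibre**: if `Φ″(0) ≤ 0` and `Φ″(1) ≤ 0` then `(1−s)Φ(0) + sΦ(1) ≤ Φ(s)` for `s ∈ [0,1]`, since
`(1−s)Φ(0) + sΦ(1) − Φ(s) = s(1−s)·[(2−s)Φ″(0) + (1+s)Φ″(1)]/6`. [this work] -/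
theorem chord_le_of_concave (p : ι → unitInterval) (e : ι) (f g h : Set ι → ℝ) {s : ℝ} (hs0 : 0 ≤ s) (hs1 : s ≤ 1)
    (h0 : cubicE3Deriv2 p e f g h 0 ≤ 0) (h1 : cubicE3Deriv2 p e f g h 1 ≤ 0) :
    (1 - s) * cubicE3 p e f g h 0 + s * cubicE3 p e f g h 1 ≤ cubicE3 p e f g h s := by
  have hC := cubicE3_chord_sub p e f g h s
  have hA := cubicE3Deriv2_affine p e f g h s
  have hD := cubicE3Deriv2_one_sub_zero p e f g h
  have key : (1 - s) * cubicE3 p e f g h 0 + s * cubicE3 p e f g h 1 - cubicE3 p e f g h s =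
      s * (1 - s) * ((2 - s) * cubicE3Deriv2 p e f g h 0 + (1 + s) * cubicE3Deriv2 p e f g h 1) / 6 := by
    rw [hC, hA]; linear_combination (-(s * (1 - s) * (1 - 2 * s) / 6)) * hD
  have hin : (2 - s) * cubicE3Deriv2 p e f g h 0 + (1 + s) * cubicE3Deriv2 p e f g h 1 ≤ 0 := by
    have a1 : (2 - s) * cubicE3Deriv2 p e f g h 0 ≤ 0 := mul_nonpos_of_nonneg_of_nonpos (by linarith) h0
    have a2 : (1 + s) * cubicE3Deriv2 p e f g h 1 ≤ 0 := mul_nonpos_of_nonneg_of_nonpos (by linarith) h1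
    linarith
  have hss : 0 ≤ s * (1 - s) := mul_nonneg hs0 (by linarith)
  have : s * (1 - s) * ((2 - s) * cubicE3Deriv2 p e f g h 0 + (1 + s) * cubicE3Deriv2 p e f g h 1) / 6 ≤ 0 := by
    have := mul_nonpos_of_nonneg_of_nonpos hss hin
    linarith
  linarith

/-- The facet/chord form for `G3`: a concave fibre at coin `e` gives `(1−p_e)G(p[e↦0]) + p_eG(p[e↦1]) ≤ G(p)`. [this work] -/
theorem G3_chord_le_of_concave (U : Fin 3 → Set (Set ι)) (p : ι → unitInterval) (e : ι)
    (h0 : cubicE3Deriv2 p e (ind (U 0)) (ind (U 1)) (ind (U 2)) 0 ≤ 0) (h1 : cubicE3Deriv2 p e (ind (U 0)) (ind (U 1)) (ind (U 2)) 1 ≤ 0) :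
    (1 - (p e : ℝ)) * G3 U (update p e 0) + (p e : ℝ) * G3 U (update p e 1) ≤ G3 U p := by
  rw [G3_update_eq, G3_update_eq, G3_eq_cubicE3 U p e, Set.Icc.coe_zero, Set.Icc.coe_one]
  exact chord_le_of_concave p e _ _ _ (p e).2.1 (p e).2.2 h0 h1

/-- **SUM-FORM for diagonal triples `(U,U,U)`** — every fibre is concave (gen 17), so every chord lies below: no stationarity needed. [this work] -/
theorem sumForm_diag (p : ι → unitInterval) (U : Set (Set ι)) :
    ∑ e ∈ liveSet p, ((1 - (p e : ℝ)) * G3 ![U, U, U] (update p e 0) + (p e : ℝ) * G3 ![U, U, U] (update p e 1)) ≤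
      ((liveSet p).card : ℝ) * G3 ![U, U, U] p := by
  refine sumForm_of_forall _ p fun e _ => G3_chord_le_of_concave _ p e ?_ ?_
  · exact cubicE3Deriv2_diag_nonpos p e U 0
  · exact cubicE3Deriv2_diag_nonpos p e U 1

/-- **SUM-FORM for a constant member `(U,V,Ω)`** — the fibres are concave parabolas (`cubicE3Deriv2_const`). [this work] -/
theorem sumForm_const (p : ι → unitInterval) {U V : Set (Set ι)} (hU : IsUpperSet U) (hV : IsUpperSet V) :
    ∑ e ∈ liveSet p, ((1 - (p e : ℝ)) * G3 ![U, V, Set.univ] (update p e 0) + (p e : ℝ) * G3 ![U, V, Set.univ] (update p e 1)) ≤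
      ((liveSet p).card : ℝ) * G3 ![U, V, Set.univ] p := by
  refine sumForm_of_forall _ p fun e _ => G3_chord_le_of_concave _ p e ?_ ?_ <;>
  · show cubicE3Deriv2 p e (ind U) (ind V) (ind (Set.univ : Set (Set ι))) _ ≤ 0
    rw [ind_univ_eq_one]
    exact cubicE3Deriv2_const_nonpos p e hU hV _


/-! ### Two more families (appended, gen 18): pairs and chains — at a STATIONARY point every chord lies below the fibre -/

/-- For a fibre cubic with `c₃ ≥ 0`: the chord lies below the value at `s ∈ [0,1]` as soon as `½Φ″(s) + (1−2s)c₃ ≤ 0` (chord identity). [this work] -/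
theorem chord_le_of_half_deriv2 (p : ι → unitInterval) (e : ι) (f g h : Set ι → ℝ) {s : ℝ} (hs0 : 0 ≤ s) (hs1 : s ≤ 1)
    (hkey : cubicE3Deriv2 p e f g h s / 2 + (1 - 2 * s) * (secDelta p e f * secDelta p e g * secDelta p e h) ≤ 0) :
    (1 - s) * cubicE3 p e f g h 0 + s * cubicE3 p e f g h 1 ≤ cubicE3 p e f g h s := by
  have hC := cubicE3_chord_sub p e f g h s
  have hss : 0 ≤ s * (1 - s) := mul_nonneg hs0 (by linarith)
  have : s * (1 - s) / 2 * cubicE3Deriv2 p e f g h s + s * (1 - s) * (1 - 2 * s) * (secDelta p e f * secDelta p e g * secDelta p e h) =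
      s * (1 - s) * (cubicE3Deriv2 p e f g h s / 2 + (1 - 2 * s) * (secDelta p e f * secDelta p e g * secDelta p e h)) := by ring
  nlinarith [mul_nonpos_of_nonneg_of_nonpos hss hkey]

/-- **Pairs `(U,U,V)`: at a stationary point of the fibre the chord lies below it** (every coin).  From the pair identity
`(1−u)Φ″ + 2Δ_UΦ′ + 2Δ_U²(2w−uv) + 2(1−u)²Δ_UΔ_V = 0`: at `Φ′ = 0`, `½Φ″ ≤ −(1−u)Δ_UΔ_V`, and `(1−u) ≥ (1−s)Δ_U ≥ (1−2s)Δ_U` absorbs the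
cubic term `(1−2s)c₃ = (1−2s)Δ_U²Δ_V`. [this work] -/
theorem chord_le_of_stationary_pair (p : ι → unitInterval) (e : ι) {U V : Set (Set ι)} (hU : IsUpperSet U) (hV : IsUpperSet V)
    (s : unitInterval) (hs : (s : ℝ) < 1) (h0 : cubicE3Deriv p e (ind U) (ind U) (ind V) s = 0) :
    (1 - (s : ℝ)) * cubicE3 p e (ind U) (ind U) (ind V) 0 + (s : ℝ) * cubicE3 p e (ind U) (ind U) (ind V) 1 ≤
      cubicE3 p e (ind U) (ind U) (ind V) s := by
  refine chord_le_of_half_deriv2 p e _ _ _ s.2.1 s.2.2 ?_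
  have hΔU : 0 ≤ secDelta p e (ind U) := sub_nonneg.2 (secEx_ind_mono p e hU)
  have hΔV : 0 ≤ secDelta p e (ind V) := sub_nonneg.2 (secEx_ind_mono p e hV)
  have hH := secM_harris p e hU hV s
  have hid := pair_fibre_identity p e U V s
  rw [h0, mul_zero, add_zero] at hid
  obtain ⟨h00, h01⟩ := secEx_ind_mem p e U false
  obtain ⟨h10, h11⟩ := secEx_ind_mem p e U true
  obtain ⟨v00, v01⟩ := secEx_ind_mem p e V false
  have hs0 : 0 ≤ (s : ℝ) := s.2.1
  have hu0 : 0 ≤ secM p e (ind U) s := by unfold secM; nlinarith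
  have hv0 : 0 ≤ secM p e (ind V) s := by unfold secM; nlinarith [(secEx_ind_mem p e V true).1]
  have huv : 0 ≤ 2 * secM p e (ind U * ind V) s - secM p e (ind U) s * secM p e (ind V) s := by nlinarith [mul_nonneg hu0 hv0]
  -- `1 − u ≥ (1 − s)·Δ_U` since `u₁ = u + (1−s)Δ_U ≤ 1`
  have h1u : (1 - (s : ℝ)) * secDelta p e (ind U) ≤ 1 - secM p e (ind U) s := by unfold secM secDelta; nlinarith
  have h1u' : 0 ≤ 1 - secM p e (ind U) s := by nlinarith [mul_nonneg (sub_nonneg.2 s.2.2) hΔU]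
  -- (1−u)·[½Φ″ + (1−2s)c₃] = −Δ_U²(2w−uv) − (1−u)²Δ_UΔ_V + (1−2s)(1−u)Δ_U²Δ_V ≤ −Δ_UΔ_V (1−u)[(1−u) − (1−2s)Δ_U] ≤ 0
  have hc3 : secDelta p e (ind U) * secDelta p e (ind U) * secDelta p e (ind V) = secDelta p e (ind U) ^ 2 * secDelta p e (ind V) := by ring
  rcases eq_or_lt_of_le h1u' with hz | hpos
  · -- `u = 1`: then Δ_U = 0 (as (1−s)Δ_U ≤ 0 with s < 1), so Φ″ = 0 and c₃ = 0
    have hΔ0 : secDelta p e (ind U) = 0 := by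
      by_contra hne
      have hDpos : 0 < secDelta p e (ind U) := lt_of_le_of_ne hΔU (Ne.symm hne)
      have : 0 < (1 - (s : ℝ)) * secDelta p e (ind U) := mul_pos (sub_pos.2 hs) hDpos
      linarith
    rw [cubicE3Deriv2_pair_eq, hΔ0]; simp
  · have key : (1 - secM p e (ind U) s) * (cubicE3Deriv2 p e (ind U) (ind U) (ind V) s / 2 +
        (1 - 2 * (s : ℝ)) * (secDelta p e (ind U) * secDelta p e (ind U) * secDelta p e (ind V))) ≤ 0 := by
      have expand : (1 - secM p e (ind U) s) * (cubicE3Deriv2 p e (ind U) (ind U) (ind V) s / 2 +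
          (1 - 2 * (s : ℝ)) * (secDelta p e (ind U) * secDelta p e (ind U) * secDelta p e (ind V))) =
          -(secDelta p e (ind U) ^ 2 * (2 * secM p e (ind U * ind V) s - secM p e (ind U) s * secM p e (ind V) s))
          - secDelta p e (ind U) * secDelta p e (ind V) * (1 - secM p e (ind U) s) * ((1 - secM p e (ind U) s) - (1 - 2 * (s : ℝ)) * secDelta p e (ind U)) := by
        linear_combination (1 / 2 : ℝ) * hid
      rw [expand]
      have t1 : 0 ≤ secDelta p e (ind U) ^ 2 * (2 * secM p e (ind U * ind V) s - secM p e (ind U) s * secM p e (ind V) s) :=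
        mul_nonneg (sq_nonneg _) huv
      have t2 : 0 ≤ (1 - secM p e (ind U) s) - (1 - 2 * (s : ℝ)) * secDelta p e (ind U) := by nlinarith [mul_nonneg hs0 hΔU]
      have t3 : 0 ≤ secDelta p e (ind U) * secDelta p e (ind V) * (1 - secM p e (ind U) s) * ((1 - secM p e (ind U) s) - (1 - 2 * (s : ℝ)) * secDelta p e (ind U)) :=
        mul_nonneg (mul_nonneg (mul_nonneg hΔU hΔV) h1u') t2
      linarith
    by_contra hc
    have : 0 < (1 - secM p e (ind U) s) * (cubicE3Deriv2 p e (ind U) (ind U) (ind V) s / 2 +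
        (1 - 2 * (s : ℝ)) * (secDelta p e (ind U) * secDelta p e (ind U) * secDelta p e (ind V))) := mul_pos hpos (not_le.1 hc)
    linarith

/-- **SUM-FORM for pair triples `(U,U,V)` at a critical point.** [this work] -/
theorem sumForm_pair (p : ι → unitInterval) {U V : Set (Set ι)} (hU : IsUpperSet U) (hV : IsUpperSet V)
    (hstat : ∀ e ∈ liveSet p, fibreSlope p e (ind U) (ind U) (ind V) = 0) :
    ∑ e ∈ liveSet p, ((1 - (p e : ℝ)) * G3 ![U, U, V] (update p e 0) + (p e : ℝ) * G3 ![U, U, V] (update p e 1)) ≤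
      ((liveSet p).card : ℝ) * G3 ![U, U, V] p := by
  refine sumForm_of_forall _ p fun e he => ?_
  rw [G3_update_eq, G3_update_eq, G3_eq_cubicE3 _ p e, Set.Icc.coe_zero, Set.Icc.coe_one]
  have hlt : ((p e : unitInterval) : ℝ) < 1 := ((mem_liveSet p e).1 he).2
  have h0 := hstat e he
  rw [fibreSlope_eq] at h0
  exact chord_le_of_stationary_pair p e hU hV (p e) hlt h0


/-- **Chains `U₁ ⊆ U₂ ⊆ U₃`: at a stationary point of the fibre the chord lies below it** (every coin).  With `X = Δ₂(2−m₃)`, `Y = (1−m₂)Δ₃`,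
`P = (1−m₂)(2−m₃)`: stationarity gives `Δ₁P = m₁(X+Y)`, `P·½Φ″ = −m₁(X²+XY+Y²)`, `Δ₂Δ₃P = XY`, and `P ≥ (1−2s)·max(X,Y)` absorbs the cubic term. [this work] -/
theorem chord_le_of_stationary_chain (p : ι → unitInterval) (e : ι) {A B C : Set (Set ι)} (hA : IsUpperSet A) (hB : IsUpperSet B)
    (hC : IsUpperSet C) (hAB : A ⊆ B) (hBC : B ⊆ C) (s : unitInterval)
    (h0 : cubicE3Deriv p e (ind A) (ind B) (ind C) s = 0) :
    (1 - (s : ℝ)) * cubicE3 p e (ind A) (ind B) (ind C) 0 + (s : ℝ) * cubicE3 p e (ind A) (ind B) (ind C) 1 ≤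
      cubicE3 p e (ind A) (ind B) (ind C) s := by
  refine chord_le_of_half_deriv2 p e _ _ _ s.2.1 s.2.2 ?_
  rw [cubicE3Deriv_chain_eq p e hAB hBC] at h0
  rw [cubicE3Deriv2_chain_eq p e hAB hBC]
  have hΔA : 0 ≤ secDelta p e (ind A) := sub_nonneg.2 (secEx_ind_mono p e hA)
  have hΔB : 0 ≤ secDelta p e (ind B) := sub_nonneg.2 (secEx_ind_mono p e hB)
  have hΔC : 0 ≤ secDelta p e (ind C) := sub_nonneg.2 (secEx_ind_mono p e hC)
  obtain ⟨a00, a01⟩ := secEx_ind_mem p e A false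
  obtain ⟨a10, a11⟩ := secEx_ind_mem p e A true
  obtain ⟨b00, b01⟩ := secEx_ind_mem p e B false
  obtain ⟨b10, b11⟩ := secEx_ind_mem p e B true
  obtain ⟨c00, c01⟩ := secEx_ind_mem p e C false
  obtain ⟨c10, c11⟩ := secEx_ind_mem p e C true
  have hs0 : 0 ≤ (s : ℝ) := s.2.1
  have hs1 : (s : ℝ) ≤ 1 := s.2.2
  have hmA : 0 ≤ secM p e (ind A) s := by unfold secM; nlinarith only [hs0, hs1, a00, a10]
  have hmB : secM p e (ind B) s ≤ 1 := by unfold secM; nlinarith only [hs0, hs1, b01, b11]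
  have hmC : secM p e (ind C) s ≤ 1 := by unfold secM; nlinarith only [hs0, hs1, c01, c11]
  have hdC1 : secDelta p e (ind C) ≤ 1 := by unfold secDelta; linarith
  have h1B : (1 - (s : ℝ)) * secDelta p e (ind B) ≤ 1 - secM p e (ind B) s := by
    unfold secM secDelta; nlinarith only [hs0, hs1, b01, b11, b00]
  set mA := secM p e (ind A) s with hmAdef
  set mB := secM p e (ind B) s with hmBdef
  set mC := secM p e (ind C) s with hmCdef
  set dA := secDelta p e (ind A) with hdA
  set dB := secDelta p e (ind B) with hdB
  set dC := secDelta p e (ind C) with hdC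
  have h2mC : 0 ≤ 2 - mC := by linarith
  have h1mB : 0 ≤ 1 - mB := by linarith
  have hP : 0 ≤ (1 - mB) * (2 - mC) := mul_nonneg h1mB h2mC
  have hX : 0 ≤ dB * (2 - mC) := mul_nonneg hΔB h2mC
  have hY : 0 ≤ (1 - mB) * dC := mul_nonneg h1mB hΔC
  have key : (1 - mB) * (2 - mC) * (mA * dB * dC - dA * dC * (1 - mB) - dA * dB * (2 - mC)) =
      -(mA * ((dB * (2 - mC)) ^ 2 + (dB * (2 - mC)) * ((1 - mB) * dC) + ((1 - mB) * dC) ^ 2)) := by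
    linear_combination (-(dB * (2 - mC)) - (1 - mB) * dC) * h0
  -- P ≥ (1−2s)X and P ≥ (1−2s)Y
  have hPX : (1 - 2 * (s : ℝ)) * (dB * (2 - mC)) ≤ (1 - mB) * (2 - mC) := by
    have h1 : (1 - (s : ℝ)) * dB * (2 - mC) ≤ (1 - mB) * (2 - mC) := mul_le_mul_of_nonneg_right h1B h2mC
    have h2 : 0 ≤ (s : ℝ) * (dB * (2 - mC)) := mul_nonneg hs0 hX
    nlinarith only [h1, h2]
  have hPY : (1 - 2 * (s : ℝ)) * ((1 - mB) * dC) ≤ (1 - mB) * (2 - mC) := by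
    have h1 : (1 - 2 * (s : ℝ)) * dC ≤ 2 - mC := by nlinarith only [hs0, hΔC, hdC1, hmC]
    have h2 := mul_le_mul_of_nonneg_left h1 h1mB
    nlinarith only [h2]
  rcases eq_or_lt_of_le hP with hP0 | hPpos
  · -- degenerate: P = 0 ⟹ m_B = 1 ⟹ m_A Δ_B = 0 (stationarity) and (1−s)Δ_B ≤ 0
    have h2C : 0 < 2 - mC := by linarith
    have h1B0 : 1 - mB = 0 := by
      rcases mul_eq_zero.1 hP0.symm with h | h
      · exact h
      · exact absurd h (ne_of_gt h2C)
    rw [h1B0] at h0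
    have hst : mA * dB * (2 - mC) = 0 := by linear_combination -h0
    have hmAdB : mA * dB = 0 := by
      rcases mul_eq_zero.1 hst with h | h
      · exact h
      · exact absurd h (ne_of_gt h2C)
    have hsdB : (1 - (s : ℝ)) * dB ≤ 0 := by linarith
    rw [h1B0]
    rcases mul_eq_zero.1 hmAdB with hmA0 | hdB0
    · rw [hmA0]
      rcases eq_or_lt_of_le hΔB with hz | hpos
      · rw [← hz]; simp
      · -- dB > 0 and (1−s) dB ≤ 0 force s = 1
        have h1s : 1 - (s : ℝ) = 0 := by
          have hge : 0 ≤ (1 - (s : ℝ)) * dB := mul_nonneg (by linarith) hΔB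
          have hz' : (1 - (s : ℝ)) * dB = 0 := le_antisymm hsdB hge
          rcases mul_eq_zero.1 hz' with h | h
          · exact h
          · exact absurd h (ne_of_gt hpos)
        have hs1' : (s : ℝ) = 1 := by linarith
        rw [hs1']
        have t1 : 0 ≤ dA * dB * (2 - mC) := mul_nonneg (mul_nonneg hΔA hΔB) h2C.le
        have t2 : 0 ≤ dA * dB * dC := mul_nonneg (mul_nonneg hΔA hΔB) hΔC
        nlinarith only [t1, t2]
    · rw [hdB0]; simp
  · -- generic: multiply the target by P² > 0
    have target_mul : (1 - mB) * (2 - mC) * ((1 - mB) * (2 - mC)) *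
        (2 * (mA * dB * dC - dA * dC * (1 - mB) - dA * dB * (2 - mC)) / 2 + (1 - 2 * (s : ℝ)) * (dA * dB * dC)) =
        -(mA * ((dB * (2 - mC)) ^ 2 + (dB * (2 - mC)) * ((1 - mB) * dC) + ((1 - mB) * dC) ^ 2)) * ((1 - mB) * (2 - mC))
          + (1 - 2 * (s : ℝ)) * (mA * (dB * (2 - mC) + (1 - mB) * dC)) * ((dB * (2 - mC)) * ((1 - mB) * dC)) := by
      linear_combination ((1 - mB) * (2 - mC)) * key + (1 - 2 * (s : ℝ)) * ((dB * (2 - mC)) * ((1 - mB) * dC)) * h0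
    have hneg : -(mA * ((dB * (2 - mC)) ^ 2 + (dB * (2 - mC)) * ((1 - mB) * dC) + ((1 - mB) * dC) ^ 2)) * ((1 - mB) * (2 - mC))
          + (1 - 2 * (s : ℝ)) * (mA * (dB * (2 - mC) + (1 - mB) * dC)) * ((dB * (2 - mC)) * ((1 - mB) * dC)) ≤ 0 := by
      set X := dB * (2 - mC) with hXdef
      set Y := (1 - mB) * dC with hYdef
      set P := (1 - mB) * (2 - mC) with hPdef
      have e1 : -(mA * (X ^ 2 + X * Y + Y ^ 2)) * P + (1 - 2 * (s : ℝ)) * (mA * (X + Y)) * (X * Y) =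
          -(mA * (X * (X * (P - (1 - 2 * (s : ℝ)) * Y)) + Y * (Y * (P - (1 - 2 * (s : ℝ)) * X)) + X * Y * P)) := by ring
      rw [e1]
      have t1 : 0 ≤ X * (X * (P - (1 - 2 * (s : ℝ)) * Y)) := mul_nonneg hX (mul_nonneg hX (by linarith))
      have t2 : 0 ≤ Y * (Y * (P - (1 - 2 * (s : ℝ)) * X)) := mul_nonneg hY (mul_nonneg hY (by linarith))
      have t3 : 0 ≤ X * Y * P := mul_nonneg (mul_nonneg hX hY) hP
      have t4 : 0 ≤ mA * (X * (X * (P - (1 - 2 * (s : ℝ)) * Y)) + Y * (Y * (P - (1 - 2 * (s : ℝ)) * X)) + X * Y * P) :=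
        mul_nonneg hmA (by linarith)
      linarith
    have hPP : 0 < (1 - mB) * (2 - mC) * ((1 - mB) * (2 - mC)) := mul_pos hPpos hPpos
    by_contra hc
    have : 0 < (1 - mB) * (2 - mC) * ((1 - mB) * (2 - mC)) *
        (2 * (mA * dB * dC - dA * dC * (1 - mB) - dA * dB * (2 - mC)) / 2 + (1 - 2 * (s : ℝ)) * (dA * dB * dC)) :=
      mul_pos hPP (not_le.1 hc)
    linarith [target_mul]

/-- **SUM-FORM for chains `U₁ ⊆ U₂ ⊆ U₃` at a critical point.** [this work] -/
theorem sumForm_chain (p : ι → unitInterval) {A B C : Set (Set ι)} (hA : IsUpperSet A) (hB : IsUpperSet B) (hC : IsUpperSet C)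
    (hAB : A ⊆ B) (hBC : B ⊆ C) (hstat : ∀ e ∈ liveSet p, fibreSlope p e (ind A) (ind B) (ind C) = 0) :
    ∑ e ∈ liveSet p, ((1 - (p e : ℝ)) * G3 ![A, B, C] (update p e 0) + (p e : ℝ) * G3 ![A, B, C] (update p e 1)) ≤
      ((liveSet p).card : ℝ) * G3 ![A, B, C] p := by
  refine sumForm_of_forall _ p fun e he => ?_
  rw [G3_update_eq, G3_update_eq, G3_eq_cubicE3 _ p e, Set.Icc.coe_zero, Set.Icc.coe_one]
  have h0 := hstat e he
  rw [fibreSlope_eq] at h0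
  exact chord_le_of_stationary_chain p e hA hB hC hAB hBC (p e) h0

end SahiSliceMinimum

end Summit.CriticalPhenomena.PercolationContinuityZ3.Theorems
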